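import Summits.QuantumFields.BalabanUV.Beta.FP.TorusGaugeCovariancePairing
import Literature.MathematicalPhysics.QuantumFieldTheory.Balaban1983to89.B5Prop11Plancherel

/-!
# `BalabanUV.Beta.FP.TorusGaugeCovarianceCoarse` — road «FP» (binder row D1), route T, (T-ID) letter «GAUGE COVARIANCE OF THE PERIODISED ROOTED
# AVERAGING, ORDER 0, BLOCK-CONSTANT SECTOR»: on the fine box `fine N M′ = (N·M′_i)_i` over the coarse box `M′`, the `N`-BLOCK-CONSTANT generator columns
# `tgradBlock M′ N` (= the Jets ∕ OneShot `D₂` before restriction to the coarse residual parameters) and the identity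
# **`Q₁₀ · D₂ = #B · D̄₀` with `D̄₀ := tgrad M′` — the COARSE BOX's torus gradient read on the coarse field slots** (LEMMA N's second input at order 0)

INTENT ∕ OFFER O-gan24leaf05-g48-3 (HOME/CLAIMS.log [GAN24LEAF05-G48-INTENT-3]); OWNER d1-p3 g17 [D1P3-G17-LANDED-4] «`𝔔`-letters from p308208's covariance master
identity»; coarse presentation = the coarse box (leaf-06 g16's `hU₂` «at the coarse torus (M∕N)»).  Unit `b2b-balaban-gan24-formalise-leaf-05` (gen 48).
HONEST FRAMING (cell contract, verbatim): «discharging `BetaPertH` makes Bałaban's UV stability UNCONDITIONAL — a real constructive-QFT result; it is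
NOT the continuum limit and NOT the Clay problem.»  HONEST DEPENDENCY: continuum YM on T⁴ ⇐ BetaPertH ∧ nine spine estimates (0/9 proved);
BetaPertH ⇐ (D1) ∧ (D4) ∧ CAP+tail; G-an2-4 gates asym, D1 and NE2/3/4.  NOT IN PRINT; OUR BOOKKEEPING ([folklore] finite sums + integer division).
No `Prop` is minted, nothing is cited; two bookkeeping `def`s (`tgradBlock`, `coarsePt`).  Discharges NO binder of row D1; NOT (T-ID) complete (orders 1, 2
of the jets programme = moving generator jets, not typed), NOT (UNI), NOT SDF, NOT D1, NOT BetaPertH, NOT continuum, NOT Clay.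

CONTENT (every `d`; coarse box `M′` with `NeZero` sides, blocking `N ≥ 1`, fine box `fine N M′`; in-block root `ρ = toSite r`).
* §1 `quo` ∕ `tdelta` compatibility: `tdelta_quo_congr` (congruence mod `(N·M′)ℤ^{d+1}` ⇒ same coarse class), `tdelta_quo_wrapPt`; the objects
  **`tgradBlock M′ N : Matrix (Idx (fine N M′) (Fib d)) ↥(pbox M′) ℝ`** (`tgradBlock_inl`, `tgradBlock_inr`), **`coarsePt M′ N p̄ : ↥(pbox (fine N M′))`**
  (`= N•p̄`); the dictionary **`tgradBlock_eq_sum_tgrad_mul`**: `tgradBlock M′ N q t = Σ_s tgrad (fine N M′) q s · tdelta M′ (quo N ↑s) t` (the block-class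
  indicator as a column combination of p308208's `tgrad`).
* §2 **`perF_bhKAt_coarsePt_mul_tgradBlock`**: `Σ_q perF (fine N M′) (bhKAt d ρ N) (coarsePt p̄, inr κ) q · tgradBlock M′ N q t = #B · tgrad M′ (p̄, inl κ) t`
  and `perF_bhKStepAt_coarsePt_mul_tgradBlock` (factor `stepScale d N j`) — **`Q₁₀ · D₂ = #B · D̄₀`**; off the coarse sublattice the multiplier rows vanish
  (`perF_bhKAt_mul_tgradBlock_of_proj_ne`).
NORMALISATION (OWNER W-FP-17-2 (2)): the scalars `#B = N^{d+1}` and `stepScale d N j` are DISPLAYED ON THE RIGHT-HAND SIDE — `D̄₀ := tgrad M′` is the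
UNNORMALISED coarse gradient and `Q₁₀` the unnormalised multiplier rows of `perF (bhKStepAt …)`.  So LEMMA N′ reads `τ₂·(Q₁₀·D₂) = (stepScale·#B)·(τ₂·tgrad M′)`,
whose `|det|` is `(stepScale·#B)^{|ρ₂|}·|det(τ₂·tgrad M′)|` = a CONSTANT times leaf-06's `1`: either feed p307295 ∕ p308750 the general constant `c₂`, or
normalise the multiplier rows by `(stepScale·#B)⁻¹` at the instance (the consumer's choice; nothing here fixes it).
-/

noncomputable section

open scoped BigOperators
open Finset

namespace Summit.QuantumFields.BalabanUV.Beta.FP.TorusGaugeCovarianceCoarse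

open Literature.Probability.LatticeModels (TorusSite Torus.proj Torus.proj_apply)
open Literature.MathematicalPhysics.QuantumFieldTheory
open Literature.MathematicalPhysics.QuantumFieldTheory.Balaban1983to89
open Literature.MathematicalPhysics.QuantumFieldTheory.Balaban1983to89.Beta
open B4TorusKernel.MultiPeriod (translate translate_apply)
open B5Prop11Plancherel (fine)
open B6Lemma24Torus (pbox mem_pbox wrap wrap_eq_self wrap_congr)
open ExpKernelCalculus (MKer)
open AffineAveraging (Form0 Form1 box toSite unitVec unitVec_apply)
open LatticeForm (quo)
open OneStepResolventKernel (Fib proj_zsmul)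
open Summit.QuantumFields.BalabanUV.Beta.BorderedHessian (bhKAt bhKStepAt stepScale)
open Summit.QuantumFields.BalabanUV.Beta.FP.KernelPeriodisationFib (Idx perF perF_apply)
open Summit.QuantumFields.BalabanUV.Beta.FP.TorusGaugeCovariance
open Summit.QuantumFields.BalabanUV.Beta.FP.TorusGaugeCovariancePairing (wrapPt wrapPt_coe sum_tdelta_mul perF_bhKAt_mul_tgrad_sum)

variable {d : ℕ}

/-! ## §1 The coarse class of a fine point; the block-constant generator columns -/

section Objects

variable (M' : Fin (d + 1) → ℕ) [∀ μ, NeZero (M' μ)] (N : ℕ) [NeZero N]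

omit [∀ μ, NeZero (M' μ)] in
/-- `quo N` of two lattice points congruent modulo `(N·M′)ℤ^{d+1}` gives coarse points congruent modulo `M′ℤ^{d+1}`, hence the same coarse class. -/
theorem tdelta_quo_congr {x x' : Fin (d + 1) → ℤ} (h : ∀ i, ((N : ℤ) * (M' i : ℤ)) ∣ x i - x' i) (t : ↥(pbox M')) :
    tdelta M' (quo N x) t = tdelta M' (quo N x') t := by
  refine tdelta_congr M' (fun i => ?_) t
  obtain ⟨k, hk⟩ := h i
  have hN : (N : ℤ) ≠ 0 := by exact_mod_cast NeZero.ne N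
  refine ⟨k, ?_⟩
  have e : x i = x' i + (N : ℤ) * ((M' i : ℤ) * k) := by linarith
  simp only [quo, e, Int.add_mul_ediv_left _ _ hN]
  ring

/-- the coarse class of the box representative of `x` in the FINE box is the coarse class of `x`. -/
theorem tdelta_quo_wrapPt (x : Fin (d + 1) → ℤ) (t : ↥(pbox M')) :
    tdelta M' (quo N (wrapPt (fine N M') x : Fin (d + 1) → ℤ)) t = tdelta M' (quo N x) t := by
  refine tdelta_quo_congr M' N (fun i => ?_) t
  rw [wrapPt_coe]
  obtain ⟨k, hk⟩ := B6Lemma24Torus.isPeriod_sub_wrap (M := fine N M') x i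
  refine ⟨-k, ?_⟩
  have hk' : x i - wrap (fine N M') x i = ((N * M' i : ℕ) : ℤ) * k := by simpa [Pi.sub_apply, fine] using hk
  push_cast at hk'
  linarith

/-- **THE BLOCK-CONSTANT GENERATOR COLUMNS** on the fine box: column `t` (a coarse box point) = the FINE lattice gradient of the indicator of the coarse class
`t` (`quo N · ≡ t mod M′`), read on the field slots; zero on the multiplier slots.  These are the `N`-block-constant extensions of the coarse gauge parameters —
the Jets ∕ OneShot generator block `D₂` before restriction to the coarse residual parameters. [our object] -/
def tgradBlock : Matrix (Idx (fine N M') (Fib d)) ↥(pbox M') ℝ :=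
  fun q t => Sum.elim
    (fun l : Fin (d + 1) => tdelta M' (quo N ((q.1 : Fin (d + 1) → ℤ) + unitVec l)) t - tdelta M' (quo N (q.1 : Fin (d + 1) → ℤ)) t)
    (fun _ : Fin (d + 1) => (0 : ℝ)) q.2

omit [∀ μ, NeZero (M' μ)] [NeZero N] in
/-- field rows of `tgradBlock`. -/
theorem tgradBlock_inl (y : ↥(pbox (fine N M'))) (l : Fin (d + 1)) (t : ↥(pbox M')) :
    tgradBlock M' N (y, Sum.inl l) t
      = tdelta M' (quo N ((y : Fin (d + 1) → ℤ) + unitVec l)) t - tdelta M' (quo N (y : Fin (d + 1) → ℤ)) t := rfl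

omit [∀ μ, NeZero (M' μ)] [NeZero N] in
/-- multiplier rows of `tgradBlock` vanish. -/
theorem tgradBlock_inr (y : ↥(pbox (fine N M'))) (κ : Fin (d + 1)) (t : ↥(pbox M')) : tgradBlock M' N (y, Sum.inr κ) t = 0 := rfl

/-- **DICTIONARY**: the block-constant column is the combination of p308208's `tgrad` columns weighted by the coarse-class indicator:
`tgradBlock M′ N q t = Σ_s tgrad (fine N M′) q s · tdelta M′ (quo N ↑s) t`. -/
theorem tgradBlock_eq_sum_tgrad_mul (q : Idx (fine N M') (Fib d)) (t : ↥(pbox M')) :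
    tgradBlock M' N q t = ∑ s : ↥(pbox (fine N M')), tgrad (fine N M') q s * tdelta M' (quo N (s : Fin (d + 1) → ℤ)) t := by
  obtain ⟨y, b⟩ := q
  rcases b with l | κ
  · rw [tgradBlock_inl]
    simp only [tgrad_inl, sub_mul, Finset.sum_sub_distrib, sum_tdelta_mul, tdelta_quo_wrapPt]
  · rw [tgradBlock_inr]
    simp only [tgrad_inr, zero_mul, Finset.sum_const_zero]

omit [∀ μ, NeZero (M' μ)] in
/-- a coarse box point scaled by `N` lies in the fine box. -/
theorem zsmul_mem_pbox_fine (p : ↥(pbox M')) : (N : ℤ) • (p : Fin (d + 1) → ℤ) ∈ pbox (fine N M') := by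
  have hp := mem_pbox.1 p.2
  refine mem_pbox.2 fun i => ?_
  have hN : (0 : ℤ) < N := by exact_mod_cast Nat.pos_of_ne_zero (NeZero.ne N)
  obtain ⟨h0, h1⟩ := hp i
  refine ⟨?_, ?_⟩
  · simp only [Pi.smul_apply, smul_eq_mul]; positivity
  · simp only [Pi.smul_apply, smul_eq_mul, fine, Nat.cast_mul]
    exact Int.mul_lt_mul_of_pos_left h1 hN

/-- **the base point of a coarse multiplier slot** in the fine box: `coarsePt M′ N p̄ = N•p̄`. [our object] -/
def coarsePt (p : ↥(pbox M')) : ↥(pbox (fine N M')) := ⟨(N : ℤ) • (p : Fin (d + 1) → ℤ), zsmul_mem_pbox_fine M' N p⟩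

omit [∀ μ, NeZero (M' μ)] in
/-- unfolding `coarsePt`. -/
theorem coarsePt_coe (p : ↥(pbox M')) : (coarsePt M' N p : Fin (d + 1) → ℤ) = (N : ℤ) • (p : Fin (d + 1) → ℤ) := rfl

omit [∀ μ, NeZero (M' μ)] in
/-- `coarsePt` lies on the coarse sublattice. -/
theorem proj_coarsePt (p : ↥(pbox M')) : Torus.proj N (coarsePt M' N p : Fin (d + 1) → ℤ) = 0 := by
  rw [coarsePt_coe]; exact proj_zsmul _

end Objects

/-! ## §2 `Q₁₀ · D₂ = #B · D̄₀`: the periodised rooted averaging of a block-constant gauge mode is `#B` times the COARSE torus gradient -/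

section Master

variable (M' : Fin (d + 1) → ℕ) [∀ μ, NeZero (M' μ)] {N : ℕ} [NeZero N] {r : Fin (d + 1) → ℕ}

/-- the block index of an in-block point `N•u + ρ`. -/
theorem quo_zsmul_add_toSite' (hr : r ∈ box (d + 1) N) (u : Fin (d + 1) → ℤ) : quo N ((N : ℤ) • u + toSite r) = u :=
  KKTFluctuationEnergy.quo_zsmul_add_toSite (N := N) u hr

/-- **MASTER-COARSE for `bhKAt`** (in-block root `ρ = toSite r`): for a coarse box point `p̄`, direction `κ`, coarse column `t`,
`Σ_q perF (fine N M′) (bhKAt d ρ N) (N•p̄, inr κ) q · tgradBlock M′ N q t = #B · tgrad M′ (p̄, inl κ) t` — **`Q₁₀ · D₂ = #B · D̄₀`** with `D̄₀` the coarse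
box's torus gradient on the coarse field slot `(p̄, κ)` (UNNORMALISED: the factor `#B` is displayed, see the module docstring's NORMALISATION note). [folklore] -/
theorem perF_bhKAt_coarsePt_mul_tgradBlock (hr : r ∈ box (d + 1) N) (p : ↥(pbox M')) (κ : Fin (d + 1)) (t : ↥(pbox M')) :
    ∑ q : Idx (fine N M') (Fib d), perF (fine N M') (bhKAt d (toSite r) N) (coarsePt M' N p, Sum.inr κ) q * tgradBlock M' N q t
      = ((box (d + 1) N).card : ℝ) * tgrad M' (p, Sum.inl κ) t := by
  -- expand the block column over `tgrad` columns and exchange the sums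
  have hx : ∑ q : Idx (fine N M') (Fib d), perF (fine N M') (bhKAt d (toSite r) N) (coarsePt M' N p, Sum.inr κ) q * tgradBlock M' N q t
      = ∑ s : ↥(pbox (fine N M')), (∑ q : Idx (fine N M') (Fib d),
          perF (fine N M') (bhKAt d (toSite r) N) (coarsePt M' N p, Sum.inr κ) q * tgrad (fine N M') q s) * tdelta M' (quo N (s : Fin (d + 1) → ℤ)) t := by
    simp only [tgradBlock_eq_sum_tgrad_mul, Finset.mul_sum, Finset.sum_mul, mul_assoc]
    exact Finset.sum_comm
  rw [hx, perF_bhKAt_mul_tgrad_sum (fine N M') hr (coarsePt M' N p) κ _, if_pos (proj_coarsePt M' N p), tdelta_quo_wrapPt,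
    tdelta_quo_wrapPt, coarsePt_coe, tgrad_inl]
  -- the two block indices: `quo N (N•p̄ + ρ + N•e_κ) = p̄ + e_κ`, `quo N (N•p̄ + ρ) = p̄`
  rw [show (N : ℤ) • (p : Fin (d + 1) → ℤ) + toSite r + (N : ℤ) • unitVec κ = (N : ℤ) • ((p : Fin (d + 1) → ℤ) + unitVec κ) + toSite r by
      rw [smul_add]; abel,
    quo_zsmul_add_toSite' hr, quo_zsmul_add_toSite' hr]

/-- off the coarse sublattice the multiplier rows vanish, hence so does the pairing with any block column. -/
theorem perF_bhKAt_mul_tgradBlock_of_proj_ne (hr : r ∈ box (d + 1) N) {p : ↥(pbox (fine N M'))} (hp : Torus.proj N (p : Fin (d + 1) → ℤ) ≠ 0)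
    (κ : Fin (d + 1)) (t : ↥(pbox M')) :
    ∑ q : Idx (fine N M') (Fib d), perF (fine N M') (bhKAt d (toSite r) N) (p, Sum.inr κ) q * tgradBlock M' N q t = 0 := by
  have hx : ∑ q : Idx (fine N M') (Fib d), perF (fine N M') (bhKAt d (toSite r) N) (p, Sum.inr κ) q * tgradBlock M' N q t
      = ∑ s : ↥(pbox (fine N M')), (∑ q : Idx (fine N M') (Fib d),
          perF (fine N M') (bhKAt d (toSite r) N) (p, Sum.inr κ) q * tgrad (fine N M') q s) * tdelta M' (quo N (s : Fin (d + 1) → ℤ)) t := by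
    simp only [tgradBlock_eq_sum_tgrad_mul, Finset.mul_sum, Finset.sum_mul, mul_assoc]
    exact Finset.sum_comm
  rw [hx, perF_bhKAt_mul_tgrad_sum (fine N M') hr p κ _, if_neg hp]

/-- **MASTER-COARSE for `bhKStepAt` at every `j`**: `Q₁₀ · D₂ = stepScale d N j · #B · D̄₀`. -/
theorem perF_bhKStepAt_coarsePt_mul_tgradBlock (hr : r ∈ box (d + 1) N) (j : ℕ) (p : ↥(pbox M')) (κ : Fin (d + 1)) (t : ↥(pbox M')) :
    ∑ q : Idx (fine N M') (Fib d), perF (fine N M') (bhKStepAt d (toSite r) N j) (coarsePt M' N p, Sum.inr κ) q * tgradBlock M' N q t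
      = stepScale d N j * (((box (d + 1) N).card : ℝ) * tgrad M' (p, Sum.inl κ) t) := by
  rw [← perF_bhKAt_coarsePt_mul_tgradBlock M' hr p κ t, Finset.mul_sum]
  refine Finset.sum_congr rfl fun q _ => ?_
  rw [perF_bhKStepAt_inr, mul_assoc]

end Master

end Summit.QuantumFields.BalabanUV.Beta.FP.TorusGaugeCovarianceCoarse

end
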